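import Summits.ValiantsHypothesis.ValiantsHypothesis.Theorems.SymPencilSingSixClassificationZeroLine
import Summits.ValiantsHypothesis.ValiantsHypothesis.Theorems.SymPencilPerFourTwoRowCorankTwo

/-!
# Route `SymPencil` — the V-side of the size-27 cell `(11, 5, 4)`, PORT of val-idea-18's cascade: DEFINITIONS
# (`--supports` stmt-ValiantsHypothesis-5674 `SdcSuperquadratic`; verbatim port of the definitions of
# `Cruxes/SdcSuperquadratic/Lines/sing_five_classification.lean` rev 10 (val-idea-18 g5) that the remaining port files use;
# PORT-PLAN-115.md (evidence #60 on 5674); rung currency only)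

The predicates and gadgets of the `(11, 5, 4)` cascade, stated once so that the port files `SymPencilSingFive*` can quote the
workfile verbatim: the square families `JointFour`, `HasJointFour`, `PerDirFour`, `PerPointFour` (memo §2), the normal forms
`InWCol`, `VFiveCrossType`, `VTorusType` of the leaves E / X, the trivial projections `perDirFour_of_jointFour`,
`perPointFour_of_jointFour`; leaf R1N's pairing entries `xf`, the one-zero-row Hessian form `Q1` (memo (I2)), the truncations
`trunc`, `zeroRows`, `truncL`, the kernel plane `kerPlane W r = W ⊓ ker (row r)` with `mem_kerPlane`, `finrank_kerPlane`, the
pairing map `Pmap`, the complementary-pair tables `ck`, `cl`, and the three residual branch statements `R1NToric`, `R1NProduct`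
(both PROVED: ✓ `SymPencilPerFourOneRowToric.r1nToric`, ✓ `SymPencilPerFourOneRowProduct.r1nProduct`, unfolded forms) and
`R1NPure`.  All are predicates / functions with parameters (no named facts).

Honest framing: definitions only (plus five one-line lemmas); the cell `(11, 5, 4)` is closed at the workfile level and modulo `hV` at
the Theorems level (✓ `SymPencilSdcPerFourCellElevenFive`); `27 ≤ sdc(per₄) ≤ 29` unchanged; the crux `SdcSuperquadratic` and
`VP ≠ VNP` untouched; no summit statement is proved here. [folklore]
-/

noncomputable section

-- single-conjunct layout: Sub = Summit, duplicated namespace component intended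
set_option linter.dupNamespace false

namespace Summit.ValiantsHypothesis.ValiantsHypothesis.Theorems.SymPencilSingFiveClassification

open MvPolynomial Module Matrix
open Literature.Computability.AlgebraicComplexity
open Summit.ValiantsHypothesis.ValiantsHypothesis.Theorems
open Summit.ValiantsHypothesis.ValiantsHypothesis.Theorems.SymPencilSingSixClassification

variable {K : Type*} [Field K]

/-! ## 0. Predicates -/

/-- A JOINT bilinear family of four squares on `W` with data `(c, β)` — VERBATIM the shape of the
bricks (`not_jointFamily_four_of_cross_pair` …) and of `jointFamily_map`. -/
def JointFour (W : Submodule K (Fin 4 × Fin 4 → K)) (c : Fin 4 → K)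
    (β : Fin 4 → ((Fin 4 × Fin 4 → K) →ₗ[K] (Fin 4 × Fin 4 → K) →ₗ[K] K)) : Prop :=
  ∀ u : Fin 4 × Fin 4 → K, ∀ y ∈ W, ∃ e₀ e₁ : K, ∀ s : K,
    eval (u + s • y) (perPoly (Fin 4) K) = e₀ + s * e₁ + s ^ 2 * ∑ k, c k * (β k u y) ^ 2

/-- `W` carries some joint family of four squares. -/
def HasJointFour (W : Submodule K (Fin 4 × Fin 4 → K)) : Prop :=
  ∃ (c : Fin 4 → K) (β : Fin 4 → ((Fin 4 × Fin 4 → K) →ₗ[K] (Fin 4 × Fin 4 → K) →ₗ[K] K)),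
    JointFour W c β

/-- Per-DIRECTION family of `≤ 4` squares (`PerDirSix` of the Defs file with `6 ↦ 4`): for every
`y ∈ W` the `s²`-coefficient of `per₄ (u + s y)` is a combination of four squares … (memo). -/
def PerDirFour (W : Submodule K (Fin 4 × Fin 4 → K)) : Prop :=
  ∀ y ∈ W, ∃ (c : Fin 4 → K) (Λ : Fin 4 → ((Fin 4 × Fin 4 → K) →ₗ[K] K)),
    ∀ u : Fin 4 × Fin 4 → K, ∃ e₀ e₁ : K, ∀ s : K,
      eval (u + s • y) (perPoly (Fin 4) K) = e₀ + s * e₁ + s ^ 2 * ∑ k, c k * (Λ k u) ^ 2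

/-- Per-POINT family of `≤ 4` squares: for every base point `u` the quadratic form
`y ↦ s²-coeff of per₄ (u + s y)` on `W` is a combination of four squares of linear forms in `y`. -/
def PerPointFour (W : Submodule K (Fin 4 × Fin 4 → K)) : Prop :=
  ∀ u : Fin 4 × Fin 4 → K, ∃ (c : Fin 4 → K) (Λ : Fin 4 → ((Fin 4 × Fin 4 → K) →ₗ[K] K)),
    ∀ y ∈ W, ∃ e₀ e₁ : K, ∀ s : K,
      eval (u + s • y) (perPoly (Fin 4) K) = e₀ + s * e₁ + s ^ 2 * ∑ k, c k * (Λ k y) ^ 2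

/-- `W ⊆ W_col(p,q;m)`: only rows `p, q` are live and their column `m` vanishes. -/
def InWCol (W : Submodule K (Fin 4 × Fin 4 → K)) (p q m : Fin 4) : Prop :=
  ∀ x ∈ W, (∀ i j : Fin 4, i ≠ p → i ≠ q → x (i, j) = 0) ∧ x (p, m) = 0 ∧ x (q, m) = 0

/-- `V₅×`-type: `W = X_{lc} ∩ {x_(l,a) = 0} ∩ {x_(b,c) = 0}` — the cross with ONE row-arm cell and ONE
column-arm cell removed (`SymPencilPerFourFiveDimFamilies`: `l = c = 0`, `a = b = 3`). -/
def VFiveCrossType (W : Submodule K (Fin 4 × Fin 4 → K)) : Prop :=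
  ∃ l c a b : Fin 4, a ≠ c ∧ b ≠ l ∧
    ∀ x : Fin 4 × Fin 4 → K, x ∈ W ↔
      ((∀ i j : Fin 4, i ≠ l → j ≠ c → x (i, j) = 0) ∧ x (l, a) = 0 ∧ x (b, c) = 0)

/-- Torus product type `V(L)` (rows): rows `σ 2, σ 3` zero, column `τ 3` of rows `σ 0, σ 1` zero,
row `σ 0` otherwise free, row `σ 1` in the plane `Σ_j θ_j x_(σ1, τ j) = 0` … (memo). -/
def VTorusType (W : Submodule K (Fin 4 × Fin 4 → K)) : Prop :=
  ∃ (σ τ : Equiv.Perm (Fin 4)) (θ : Fin 4 → K), θ 3 = 0 ∧ θ ≠ 0 ∧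
    ∀ x : Fin 4 × Fin 4 → K, x ∈ W ↔
      ((∀ j, x (σ 2, j) = 0) ∧ (∀ j, x (σ 3, j) = 0) ∧ x (σ 0, τ 3) = 0 ∧ x (σ 1, τ 3) = 0 ∧
        ∑ j, θ j * x (σ 1, τ j) = 0)

/-! ## 1. Joint ⇒ per-direction and per-point (trivial projections) -/

/-- A joint family is a per-direction family for every `y` (`Λ_k = β_k(·, y)`). [folklore] -/
theorem perDirFour_of_jointFour {W : Submodule K (Fin 4 × Fin 4 → K)} {c : Fin 4 → K}
    {β : Fin 4 → ((Fin 4 × Fin 4 → K) →ₗ[K] (Fin 4 × Fin 4 → K) →ₗ[K] K)}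
    (h : JointFour W c β) : PerDirFour W := by
  intro y hy
  refine ⟨c, fun k => (β k).flip y, fun u => ?_⟩
  obtain ⟨e₀, e₁, he⟩ := h u y hy
  exact ⟨e₀, e₁, fun s => by simpa only [LinearMap.flip_apply] using he s⟩

/-- A joint family is a per-point family for every `u` (`Λ_k = β_k(u, ·)`). [folklore] -/
theorem perPointFour_of_jointFour {W : Submodule K (Fin 4 × Fin 4 → K)} {c : Fin 4 → K}
    {β : Fin 4 → ((Fin 4 × Fin 4 → K) →ₗ[K] (Fin 4 × Fin 4 → K) →ₗ[K] K)}
    (h : JointFour W c β) : PerPointFour W := by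
  intro u
  refine ⟨c, fun k => β k u, fun y hy => ?_⟩
  obtain ⟨e₀, e₁, he⟩ := h u y hy
  exact ⟨e₀, e₁, fun s => he s⟩

/-! ## Pairing entries, the one-zero-row Hessian form, truncations (leaf R1N tools, memo §6.2) -/

/-- The pairing entry `x_{km}(y) = y_{p,k} y_{q,m} + y_{p,m} y_{q,k}` of the live rows `p, q`. -/
def xf (p q k m : Fin 4) (y : Fin 4 × Fin 4 → K) : K := y (p, k) * y (q, m) + y (p, m) * y (q, k)

/-- `xf` is symmetric in its two column indices. -/
theorem xf_comm (p q k m : Fin 4) (y : Fin 4 × Fin 4 → K) : xf p q k m y = xf p q m k y := by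
  unfold xf; ring

/-- The `s²`-coefficient of `per₄ (u + s y)` at a direction `y` with row `3` zero (memo (I2)):
`Q_y(u) = u₃ᵀ · (P(y₁,y₂) u₀ + P(y₀,y₂) u₁ + P(y₀,y₁) u₂)`, written out. -/
def Q1 (y u : Fin 4 × Fin 4 → K) : K :=
    u (3, 0) * u (0, 1) * xf 1 2 2 3 y + u (3, 0) * u (0, 2) * xf 1 2 1 3 y + u (3, 0) * u (0, 3) * xf 1 2 1 2 y +
    u (3, 1) * u (0, 0) * xf 1 2 2 3 y + u (3, 1) * u (0, 2) * xf 1 2 0 3 y + u (3, 1) * u (0, 3) * xf 1 2 0 2 y +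
    u (3, 2) * u (0, 0) * xf 1 2 1 3 y + u (3, 2) * u (0, 1) * xf 1 2 0 3 y + u (3, 2) * u (0, 3) * xf 1 2 0 1 y +
    u (3, 3) * u (0, 0) * xf 1 2 1 2 y + u (3, 3) * u (0, 1) * xf 1 2 0 2 y + u (3, 3) * u (0, 2) * xf 1 2 0 1 y +
    u (3, 0) * u (1, 1) * xf 0 2 2 3 y + u (3, 0) * u (1, 2) * xf 0 2 1 3 y + u (3, 0) * u (1, 3) * xf 0 2 1 2 y +
    u (3, 1) * u (1, 0) * xf 0 2 2 3 y + u (3, 1) * u (1, 2) * xf 0 2 0 3 y + u (3, 1) * u (1, 3) * xf 0 2 0 2 y +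
    u (3, 2) * u (1, 0) * xf 0 2 1 3 y + u (3, 2) * u (1, 1) * xf 0 2 0 3 y + u (3, 2) * u (1, 3) * xf 0 2 0 1 y +
    u (3, 3) * u (1, 0) * xf 0 2 1 2 y + u (3, 3) * u (1, 1) * xf 0 2 0 2 y + u (3, 3) * u (1, 2) * xf 0 2 0 1 y +
    u (3, 0) * u (2, 1) * xf 0 1 2 3 y + u (3, 0) * u (2, 2) * xf 0 1 1 3 y + u (3, 0) * u (2, 3) * xf 0 1 1 2 y +
    u (3, 1) * u (2, 0) * xf 0 1 2 3 y + u (3, 1) * u (2, 2) * xf 0 1 0 3 y + u (3, 1) * u (2, 3) * xf 0 1 0 2 y +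
    u (3, 2) * u (2, 0) * xf 0 1 1 3 y + u (3, 2) * u (2, 1) * xf 0 1 0 3 y + u (3, 2) * u (2, 3) * xf 0 1 0 1 y +
    u (3, 3) * u (2, 0) * xf 0 1 1 2 y + u (3, 3) * u (2, 1) * xf 0 1 0 2 y + u (3, 3) * u (2, 2) * xf 0 1 0 1 y

/-- The two-row truncation of `y` to the rows `p, q`. -/
def trunc (p q : Fin 4) (y : Fin 4 × Fin 4 → K) : Fin 4 × Fin 4 → K :=
  fun x => if x.1 = p then y (p, x.2) else if x.1 = q then y (q, x.2) else 0

/-- The truncation vanishes off the rows `p, q`. -/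
theorem trunc_supp (p q : Fin 4) (y : Fin 4 × Fin 4 → K) :
    ∀ i j : Fin 4, i ≠ p → i ≠ q → trunc p q y (i, j) = 0 := by
  intro i j hip hiq
  simp [trunc, hip, hiq]

/-- Zeroing the rows `p, q` of `u` (a linear map). -/
def zeroRows (p q : Fin 4) : (Fin 4 × Fin 4 → K) →ₗ[K] (Fin 4 × Fin 4 → K) where
  toFun u x := if x.1 = p ∨ x.1 = q then 0 else u x
  map_add' u v := by
    ext x
    simp only [Pi.add_apply]
    split_ifs <;> simp
  map_smul' c u := by
    ext x
    simp only [Pi.smul_apply, smul_eq_mul, RingHom.id_apply]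
    split_ifs <;> simp

/-- `zeroRows`, evaluated. -/
theorem zeroRows_apply (p q : Fin 4) (u : Fin 4 × Fin 4 → K) (x : Fin 4 × Fin 4) :
    zeroRows p q u x = if x.1 = p ∨ x.1 = q then 0 else u x := rfl

/-- Truncation to the rows `p, q` as a linear map. -/
def truncL (p q : Fin 4) : (Fin 4 × Fin 4 → K) →ₗ[K] (Fin 4 × Fin 4 → K) where
  toFun := trunc p q
  map_add' x y := by
    ext z
    simp only [trunc, Pi.add_apply]
    split_ifs <;> simp
  map_smul' c x := by
    ext z
    simp only [trunc, Pi.smul_apply, smul_eq_mul, RingHom.id_apply]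
    split_ifs <;> simp

/-- `truncL` is `trunc`. -/
theorem truncL_apply (p q : Fin 4) (y : Fin 4 × Fin 4 → K) : truncL p q y = trunc p q y := rfl

/-! ## The kernel plane of a live row, the pairing map, complementary-pair tables (memo §6.4) -/

/-- The kernel plane `K_r = {k ∈ W : row r of k = 0}` (as an ambient submodule). -/
def kerPlane (W : Submodule K (Fin 4 × Fin 4 → K)) (r : Fin 4) :
    Submodule K (Fin 4 × Fin 4 → K) :=
  W ⊓ LinearMap.ker (rowL (K := K) r)

/-- Membership in the kernel plane. -/
theorem mem_kerPlane (W : Submodule K (Fin 4 × Fin 4 → K)) (r : Fin 4)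
    (d : Fin 4 × Fin 4 → K) : d ∈ kerPlane W r ↔ d ∈ W ∧ row d r = 0 := by
  simp only [kerPlane, Submodule.mem_inf, LinearMap.mem_ker, rowL_apply]

/-- rank–nullity for the row-`r` map on `W`. [folklore] -/
theorem finrank_kerPlane (W : Submodule K (Fin 4 × Fin 4 → K)) (r : Fin 4) :
    finrank K (kerPlane W r) + finrank K (W.map (rowL (K := K) r)) = finrank K W := by
  set f : W →ₗ[K] (Fin 4 → K) := (rowL (K := K) r).comp W.subtype with hf
  have hk : (LinearMap.ker f).map W.subtype = kerPlane W r := by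
    ext d
    rw [mem_kerPlane, Submodule.mem_map]
    constructor
    · rintro ⟨w, hw, rfl⟩
      rw [LinearMap.mem_ker] at hw
      exact ⟨w.2, hw⟩
    · rintro ⟨hd, hdr⟩
      exact ⟨⟨d, hd⟩, by rw [LinearMap.mem_ker]; exact hdr, rfl⟩
  have hrange : LinearMap.range f = W.map (rowL (K := K) r) := by
    rw [hf, LinearMap.range_comp, Submodule.range_subtype]
  have h1 := LinearMap.finrank_range_add_finrank_ker f
  rw [hrange] at h1
  rw [← hk, Submodule.finrank_map_subtype_eq]
  omega

/-- The map `u ↦ P(a,b) u = (T3 u a b l)_l` (linear in `u`). -/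
def Pmap (a b : Fin 4 → K) : (Fin 4 → K) →ₗ[K] (Fin 4 → K) where
  toFun u l := T3 u a b l
  map_add' u u' := by
    ext l
    exact T3_add₁ u u' a b l
  map_smul' c u := by
    ext l
    rw [Pi.smul_apply, T3_smul₁, smul_eq_mul, RingHom.id_apply]

/-- `Pmap`, evaluated. -/
theorem Pmap_apply (a b u : Fin 4 → K) (l : Fin 4) : Pmap a b u l = T3 u a b l := rfl

/-- complementary pair tables: for `p ≠ q`, `(ck p q, cl p q)` is the complement of `{p,q}`. -/
def ck (p q : Fin 4) : Fin 4 := ![![0, 2, 1, 1], ![2, 0, 0, 0], ![1, 0, 0, 0], ![1, 0, 0, 0]] p q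
/-- see `ck` -/
def cl (p q : Fin 4) : Fin 4 := ![![1, 3, 3, 2], ![3, 1, 3, 2], ![3, 3, 1, 1], ![2, 2, 1, 1]] p q

/-- The two table entries differ. -/
theorem ck_ne_cl : ∀ p q : Fin 4, p ≠ q → ck p q ≠ cl p q := by decide

/-! ## The three residual branches of leaf R1N (memo §6.4–6.6) -/

/-- Residual branch **TORIC** (memo §6.6): in the R1N normal form, every live row has rank `≤ 2`. -/
def R1NToric (K : Type*) [Field K] : Prop :=
  ∀ W : Submodule K (Fin 4 × Fin 4 → K), Sing3 W → finrank K W = 5 →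
    (∀ x ∈ W, ∀ j : Fin 4, x (3, j) = 0) →
    ¬ (∃ j : Fin 4, ∀ x ∈ W, ∀ i : Fin 4, x (i, j) = 0) →
    ¬ TwoZeroRows W → ¬ InCross W → PerDirFour W →
    (∀ r : Fin 4, finrank K (W.map (rowL (K := K) r)) ≤ 2) → False

/-- Residual branch **PRODUCT** (memo §6.5): some live row `r` has rank `3` and its kernel plane
`K_r = {d ∈ W : row r = 0}` is a PRODUCT plane `K(0;ℓ;0) ⊕ K(0;0;ℓ^σ)` … (memo). -/
def R1NProduct (K : Type*) [Field K] : Prop :=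
  ∀ W : Submodule K (Fin 4 × Fin 4 → K), Sing3 W → finrank K W = 5 →
    (∀ x ∈ W, ∀ j : Fin 4, x (3, j) = 0) →
    ¬ (∃ j : Fin 4, ∀ x ∈ W, ∀ i : Fin 4, x (i, j) = 0) →
    ¬ TwoZeroRows W → ¬ InCross W → PerDirFour W →
    ∀ r s t : Fin 4, r ≠ s → r ≠ t → s ≠ t → r ≠ 3 → s ≠ 3 → t ≠ 3 →
    finrank K (W.map (rowL (K := K) r)) = 3 →
    (∃ (j c : Fin 4) (α β : K), j ≠ c ∧ (α ≠ 0 ∨ β ≠ 0) ∧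
      ∀ d, (d ∈ W ∧ row d r = 0) ↔ ((∀ i, i ≠ s → i ≠ t → row d i = 0) ∧
        (∃ μ : K, row d s = μ • lvec j c α β) ∧ (∃ ν : K, row d t = ν • lvec j c α (-β)))) →
    False

/-- Residual branch **PURE** (memo §6.4, to be discharged below): some live row `r` has rank `3`
and its kernel plane is pure (row `s ≡ 0` on it). -/
def R1NPure (K : Type*) [Field K] : Prop :=
  ∀ W : Submodule K (Fin 4 × Fin 4 → K), Sing3 W → finrank K W = 5 →
    (∀ x ∈ W, ∀ j : Fin 4, x (3, j) = 0) →
    ¬ (∃ j : Fin 4, ∀ x ∈ W, ∀ i : Fin 4, x (i, j) = 0) →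
    ¬ TwoZeroRows W → ¬ InCross W → PerDirFour W →
    ∀ r s t : Fin 4, r ≠ s → r ≠ t → s ≠ t → r ≠ 3 → s ≠ 3 → t ≠ 3 →
    finrank K (W.map (rowL (K := K) r)) = 3 →
    (∀ d ∈ W, row d r = 0 → row d s = 0) → False


end Summit.ValiantsHypothesis.ValiantsHypothesis.Theorems.SymPencilSingFiveClassification
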